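import Literature.Analysis.Calculus.MixedPartialDerivWithin   -- ★ `iteratedFDerivWithin_apply_eq_append` (Coleman §4.5: mixed partials as appended slots)
import Mathlib.Analysis.Calculus.IteratedDeriv.Lemmas
import Mathlib.Analysis.Calculus.ContDiff.Basic
import HarnessLib

/-!
# Ray jets of a function that is `Cⁿ` on an open set: line restriction = diagonal of the Fréchet jet (LOCAL form), locality, continuity in the base point,
# ONE-SIDED limits along an open side, and the mixed reading `∂_t²∂_s f(x + t v + s w)|₀ = D³f(x)(v, v, w)` (folklore; Dieudonné (8.12), Coleman §4.5)

Topic `Analysis/Calculus`; namespace `Literature.Analysis.Calculus`.  THEOREMS ONLY (Mathlib + ★ `MixedPartialDerivWithin`; no `def`, no instance, no notation,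
no axiom, no named fact, no `sorry`).  Written for the cell `pub/hodgecm-mathlib` (ENGINE T1, crux H413 = `stmt-HodgeConjecture-24833`), ROAD A toward the letter N1
`ArchCentralLimitFormulaRankTwo` (LEAD F0P3a-plan (g10) WORD T9-8 (D): (A5)-skeleton at a NONCOMPACT wall, A-p18 (g25)): the letter's functional is a signed sum of THIRD RAY
DERIVATIVES `iteratedDeriv 3 (s ↦ F(x + s • v_ε)) 0` of a function `F` that is smooth only on an OPEN subset (the regular set, or one open side of a wall).  Everything the
wall∕chamber bookkeeping needs about ONE ray is here, for a general real normed space `E`, a general order `k ≤ n` and a general target `F`: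
* `iteratedDeriv_comp_line_of_le` — for `f` of class `Cⁿ` on the OPEN set `U` and `x + t • v ∈ U`: `iteratedDeriv k (s ↦ f(x + s • v)) t = Dᵏf(x + t • v)(v, …, v)` (`k ≤ n`; the
  global-`ContDiff` form is ★ `LineRestrictionIteratedDeriv.iteratedDeriv_lineRestriction`, the `C^∞`-on-open form ★ `AnalyticOfFDerivBound.iteratedDeriv_comp_line`; this is the
  finite-order local form), and its `t = 0` reading `iteratedDeriv_comp_line_zero_of_le`;
* `iteratedDeriv_comp_line_congr_of_eventuallyEq` — LOCALITY: the ray jet at `x` only sees the germ of `f` at `x`;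
* `continuousAt_iteratedDeriv_comp_line` — the ray jet is CONTINUOUS in the base point on `U`;
* `tendsto_iteratedDeriv_comp_line_nhdsWithin_of_eqOn` — ONE-SIDED LIMITS: if `f = g` on an open set `S` (one side of a wall, one Weyl chamber) and `g` is `Cⁿ` near `x₀` (a point of the
  wall, the corner), then the ray jet of `f` tends, WITHIN `S`, to the ray jet of `g` at `x₀` — `f` itself may be discontinuous across `∂S`;
* `iteratedDeriv_two_deriv_comp_plane_eq` — the MIXED READING `iteratedDeriv 2 (t ↦ deriv (s ↦ f(x + t • v + s • w)) 0) 0 = D³f(x) ![v, v, w]` for `f` of class `C³` near `x`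
  (outer derivatives occupy the first slots, Mathlib's convention; ★ `iteratedFDerivWithin_apply_eq_append`).
HONEST LABEL: calculus bookkeeping; it proves nothing about HC_CM, which is proved only modulo the printed citations until rung 0 closes.

## References
* [Dieudonne1960] J. Dieudonné, *Foundations of Modern Analysis* (1960), Ch. VIII §12 (8.12.1)–(8.12.4).
* [Coleman2012] R. Coleman, *Calculus on Normed Vector Spaces*, Universitext (2012), §4.5.
-/

set_option autoImplicit false

noncomputable section

open Set Filter Topology

namespace Literature.Analysis.Calculus

universe u

section Line

variable {E F : Type*} [NormedAddCommGroup E] [NormedSpace ℝ E] [NormedAddCommGroup F] [NormedSpace ℝ F]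

/-- **Line restriction = diagonal of the jet (finite order, local on an open set).**  For `f` of class `Cⁿ` on the open set `U`, `x + t • v ∈ U` and `k ≤ n`:
`iteratedDeriv k (s ↦ f (x + s • v)) t = Dᵏf(x + t • v)(v, …, v)` (chain rule for the affine line, Mathlib `ContinuousLinearMap.iteratedFDerivWithin_comp_right`).
[cite: Dieudonne1960, Ch. VIII §12 (8.12.1)] [cite: Coleman2012, §4.5] -/
theorem iteratedDeriv_comp_line_of_le {n : WithTop ℕ∞} {f : E → F} {U : Set E} (hU : IsOpen U) (hf : ContDiffOn ℝ n f U)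
    (x v : E) {t : ℝ} (ht : x + t • v ∈ U) {k : ℕ} (hk : (k : WithTop ℕ∞) ≤ n) :
    iteratedDeriv k (fun s : ℝ => f (x + s • v)) t = iteratedFDeriv ℝ k f (x + t • v) fun _ => v := by
  set L : ℝ →L[ℝ] E := ContinuousLinearMap.toSpanSingleton ℝ v with hL
  have hLapply : ∀ s : ℝ, L s = s • v := fun s => ContinuousLinearMap.toSpanSingleton_apply ℝ v s
  set f₁ : E → F := fun z => f (x + z) with hf₁
  set U₁ : Set E := (fun z => x + z) ⁻¹' U with hU₁
  have hU₁o : IsOpen U₁ := hU.preimage (by fun_prop)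
  have hf₁U : ContDiffOn ℝ n f₁ U₁ := hf.comp (contDiff_const.add contDiff_id).contDiffOn fun z hz => hz
  have hLU : IsOpen (L ⁻¹' U₁) := hU₁o.preimage L.continuous
  have htL : L t ∈ U₁ := by
    show x + L t ∈ U
    rwa [hLapply]
  have hcomp : f₁ ∘ L = fun s : ℝ => f (x + s • v) := by
    funext s
    simp [hf₁, hLapply]
  have h1 := ContinuousLinearMap.iteratedFDerivWithin_comp_right L hf₁U hU₁o.uniqueDiffOn hLU.uniqueDiffOn htL (i := k) hk
  rw [iteratedFDerivWithin_of_isOpen k hLU (by exact htL), iteratedFDerivWithin_of_isOpen k hU₁o htL, hcomp] at h1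
  rw [iteratedDeriv_eq_iteratedFDeriv, h1, ContinuousMultilinearMap.compContinuousLinearMap_apply, hf₁, iteratedFDeriv_comp_add_left, hLapply]
  simp [hLapply]

/-- **Ray jet at the base point**: `iteratedDeriv k (s ↦ f (x + s • v)) 0 = Dᵏf(x)(v, …, v)` for `f` of class `Cⁿ` on an open `U ∋ x`, `k ≤ n`.
[cite: Dieudonne1960, Ch. VIII §12 (8.12.1)] -/
theorem iteratedDeriv_comp_line_zero_of_le {n : WithTop ℕ∞} {f : E → F} {U : Set E} (hU : IsOpen U) (hf : ContDiffOn ℝ n f U)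
    {x : E} (hx : x ∈ U) (v : E) {k : ℕ} (hk : (k : WithTop ℕ∞) ≤ n) :
    iteratedDeriv k (fun s : ℝ => f (x + s • v)) 0 = iteratedFDeriv ℝ k f x fun _ => v := by
  have h := iteratedDeriv_comp_line_of_le hU hf x v (t := 0) (by simpa using hx) hk
  simpa using h

/-- **LOCALITY of the ray jet**: if `f` and `g` agree near `x`, their `k`-th ray derivatives at `x` agree (the ray `s ↦ x + s • v` passes through `x` at `s = 0`; Mathlib
`Filter.EventuallyEq.iteratedDeriv_eq`).  No differentiability needed. [cite: Dieudonne1960, Ch. VIII §12] -/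
theorem iteratedDeriv_comp_line_congr_of_eventuallyEq {f g : E → F} {x : E} (h : f =ᶠ[𝓝 x] g) (v : E) (k : ℕ) :
    iteratedDeriv k (fun s : ℝ => f (x + s • v)) 0 = iteratedDeriv k (fun s : ℝ => g (x + s • v)) 0 := by
  refine Filter.EventuallyEq.iteratedDeriv_eq k ?_
  have hc : Continuous fun s : ℝ => x + s • v := by fun_prop
  have ht : Tendsto (fun s : ℝ => x + s • v) (𝓝 0) (𝓝 x) := by
    simpa using hc.tendsto 0
  exact ht.eventually h

/-- **CONTINUITY of the ray jet in the base point**: for `f` of class `Cⁿ` on an open `U ∋ x₀` and `k ≤ n`, `x ↦ iteratedDeriv k (s ↦ f (x + s • v)) 0` is continuous at `x₀`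
(it agrees near `x₀` with `x ↦ Dᵏf(x)(v, …, v)`, and `Dᵏf` is continuous on `U`: Mathlib `ContDiffOn.continuousOn_iteratedFDerivWithin`). [cite: Dieudonne1960, Ch. VIII §12 (8.12.1)] -/
theorem continuousAt_iteratedDeriv_comp_line {n : WithTop ℕ∞} {f : E → F} {U : Set E} (hU : IsOpen U) (hf : ContDiffOn ℝ n f U)
    {x₀ : E} (hx₀ : x₀ ∈ U) (v : E) {k : ℕ} (hk : (k : WithTop ℕ∞) ≤ n) :
    ContinuousAt (fun x : E => iteratedDeriv k (fun s : ℝ => f (x + s • v)) 0) x₀ := by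
  have hcont : ContinuousAt (fun x : E => iteratedFDerivWithin ℝ k f U x fun _ => v) x₀ := by
    have hD : ContinuousAt (iteratedFDerivWithin ℝ k f U) x₀ :=
      (hf.continuousOn_iteratedFDerivWithin hk hU.uniqueDiffOn).continuousAt (hU.mem_nhds hx₀)
    exact (ContinuousMultilinearMap.apply ℝ (fun _ : Fin k => E) F fun _ => v).continuous.continuousAt.comp hD
  refine hcont.congr ?_
  filter_upwards [hU.mem_nhds hx₀] with x hx
  rw [iteratedDeriv_comp_line_zero_of_le hU hf hx v hk, ← iteratedFDerivWithin_of_isOpen k hU hx]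

/-- **ONE-SIDED LIMITS of the ray jet.**  Let `S` be OPEN (one side of a wall, one Weyl chamber), `f = g` on `S`, and `g` of class `Cⁿ` on an open `U ∋ x₀` (`x₀` may lie on `∂S`:
a wall point, the corner).  Then, for `k ≤ n`, `iteratedDeriv k (s ↦ f (x + s • v)) 0 → iteratedDeriv k (s ↦ g (x₀ + s • v)) 0` as `x → x₀` WITHIN `S` — although `f` itself may
jump across `∂S` (Harish-Chandra's situation at a noncompact wall).  Locality on the open `S` + continuity of `g`'s ray jet. [cite: Dieudonne1960, Ch. VIII §12 (8.12.1)] -/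
theorem tendsto_iteratedDeriv_comp_line_nhdsWithin_of_eqOn {n : WithTop ℕ∞} {f g : E → F} {S U : Set E} (hS : IsOpen S) (hfg : EqOn f g S)
    (hU : IsOpen U) (hg : ContDiffOn ℝ n g U) {x₀ : E} (hx₀ : x₀ ∈ U) (v : E) {k : ℕ} (hk : (k : WithTop ℕ∞) ≤ n) :
    Tendsto (fun x : E => iteratedDeriv k (fun s : ℝ => f (x + s • v)) 0) (𝓝[S] x₀)
      (𝓝 (iteratedDeriv k (fun s : ℝ => g (x₀ + s • v)) 0)) := by
  have hlim : Tendsto (fun x : E => iteratedDeriv k (fun s : ℝ => g (x + s • v)) 0) (𝓝[S] x₀)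
      (𝓝 (iteratedDeriv k (fun s : ℝ => g (x₀ + s • v)) 0)) :=
    ((continuousAt_iteratedDeriv_comp_line hU hg hx₀ v hk).tendsto).mono_left nhdsWithin_le_nhds
  refine hlim.congr' ?_
  filter_upwards [self_mem_nhdsWithin] with x hx
  exact (iteratedDeriv_comp_line_congr_of_eventuallyEq (Filter.eventuallyEq_of_mem (hS.mem_nhds hx) hfg) v k).symm

end Line

section Mixed

variable {E F : Type u} [NormedAddCommGroup E] [NormedSpace ℝ E] [NormedAddCommGroup F] [NormedSpace ℝ F]

omit [NormedAddCommGroup E] [NormedSpace ℝ E] in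
/-- `Fin.append (fun _ : Fin 2 => v) (fun _ : Fin 1 => w) = ![v, v, w]` (slot bookkeeping for the mixed reading). [cite: Coleman2012, §4.5] -/
theorem append_const_two_const_one (v w : E) : Fin.append (fun _ : Fin 2 => v) (fun _ : Fin 1 => w) = ![v, v, w] := by
  ext i
  fin_cases i <;> rfl

/-- **THE MIXED READING `∂_t²∂_s f(x + t v + s w)|₀ = D³f(x)(v, v, w)`** for `f` of class `Cⁿ` (`3 ≤ n`) on an open `U ∋ x` (outer derivatives in the first slots — Mathlib's convention;
★ `iteratedFDerivWithin_apply_eq_append` with `α = 2`, `β = 1`).  In ROAD A this is the tangential second derivative ALONG a wall of the wall-normal first derivative.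
[cite: Coleman2012, §4.5] [cite: Dieudonne1960, Ch. VIII §12 (8.12.4)] -/
theorem iteratedDeriv_two_deriv_comp_plane_eq {n : WithTop ℕ∞} {f : E → F} {U : Set E} (hU : IsOpen U) (hf : ContDiffOn ℝ n f U) (hn : (3 : WithTop ℕ∞) ≤ n)
    {x : E} (hx : x ∈ U) (v w : E) :
    iteratedDeriv 2 (fun t : ℝ => deriv (fun s : ℝ => f (x + t • v + s • w)) 0) 0 = iteratedFDeriv ℝ 3 f x ![v, v, w] := by
  -- the wall-normal first derivative as a function of the base point, read through `D¹_U f`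
  set φ : E → F := fun y => iteratedFDerivWithin ℝ 1 f U y fun _ => w with hφ
  have h1n : (1 : WithTop ℕ∞) ≤ n := le_trans (by exact_mod_cast (by norm_num : (1 : ℕ) ≤ 3)) hn
  have h2n : (2 : WithTop ℕ∞) ≤ n := le_trans (by exact_mod_cast (by norm_num : (2 : ℕ) ≤ 3)) hn
  -- (i) near `t = 0` the inner derivative is `φ (x + t • v)`
  have hφray : ∀ y ∈ U, deriv (fun s : ℝ => f (y + s • w)) 0 = φ y := by
    intro y hy
    have h := iteratedDeriv_comp_line_zero_of_le hU hf hy w (k := 1) h1n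
    rw [iteratedDeriv_one] at h
    rw [h, hφ, ← iteratedFDerivWithin_of_isOpen 1 hU hy]
  have hev : (fun t : ℝ => deriv (fun s : ℝ => f (x + t • v + s • w)) 0) =ᶠ[𝓝 0] fun t : ℝ => φ (x + t • v) := by
    have hc : Continuous fun t : ℝ => x + t • v := by fun_prop
    have ht : Tendsto (fun t : ℝ => x + t • v) (𝓝 0) (𝓝 x) := by simpa using hc.tendsto 0
    filter_upwards [ht.eventually (hU.mem_nhds hx)] with t hxt
    exact hφray (x + t • v) hxt
  rw [Filter.EventuallyEq.iteratedDeriv_eq 2 hev]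
  -- (ii) `φ` is `C²` on `U`, so its second ray derivative is `D²φ(x)(v, v)`
  have hφU : ContDiffOn ℝ 2 φ U := by
    have h21 : (2 : WithTop ℕ∞) + 1 ≤ n := by
      have h3 : (2 : WithTop ℕ∞) + 1 = 3 := by norm_num
      rw [h3]; exact hn
    have hD : ContDiffOn ℝ 2 (iteratedFDerivWithin ℝ 1 f U) U := fun y hy =>
      (hf y hy).iteratedFDerivWithin_right hU.uniqueDiffOn h21 hy
    exact (ContinuousMultilinearMap.apply ℝ (fun _ : Fin 1 => E) F fun _ => w).contDiff.comp_contDiffOn hD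
  rw [iteratedDeriv_comp_line_zero_of_le hU hφU hx v (k := 2) le_rfl, ← iteratedFDerivWithin_of_isOpen 2 hU hx]
  -- (iii) `D²_U[y ↦ D¹_U f(y)(w)](x)(v, v) = D³_U f(x)(v, v, w)`
  rw [hφ, iteratedFDerivWithin_apply_eq_append hU.uniqueDiffOn hx hf (α := 2) (β := 1) (by exact_mod_cast hn) (fun _ => v) (fun _ => w),
    iteratedFDerivWithin_of_isOpen 3 hU hx, append_const_two_const_one]

end Mixed

end Literature.Analysis.Calculus

end
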